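import Summits.HodgeConjecture.CorCM.Census.HalfParityFloor
import Summits.HodgeConjecture.CorCM.Census.HalfParityBlocks

/-!
# The half-parity law, VII: the structure of `t(G, c)` — canonicity on the parity kernel and the bound `t ≤ (1 + δ)·h`

COR-CM (cell `pub-hodgecm2`), count-neutral kernel combinatorics by the binder seat b09 (gen 30; lane HALF-PARITY-LAW), part VII,
sequel of `Census/HalfParityFloor.lean` (III: `admHalves`, `hpi`, `t = halfRank`, the floor `β − 1 − δ + t ≤ φ₂`) and
`Census/HalfParityBlocks.lean` (II: `halfOf`, the relations classified, canonicity).  Two bookkeeping definitions (`relOf`, `refPi`)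
+ theorems; no `Prop`-valued definition, no `decide` beyond identities in `𝔽₂` with ≤ 2 variables, no certificate, no named fact, no
`sorry`.  HONEST FRAMING: `HC_CM` is NOT proved; nothing here is a period or a headline.

CONTENT — how large can André-3's `t` be?
* §1 **No index-two subgroup contains `c` ⇒ `t = 0`** (`halfRank_eq_zero_of_forall_not_mem`; `SL(2,3)`, `ℤ/2×A₄`, … in the
  atlas): there is no admissible half-block set at all.
* §2 **Canonicity on the parity kernel** (`hsum_eq_hsum_of_par2_eq_zero`): two half-block sets of the same `H` with the same
  saturation agree on every vector with vanishing block parities (part II canonicity: they differ by a parity combination).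
* §3 **Reference half-parities** `ψ(H, i) = hsum (halfOf H (relOf T₀ i))` for the three candidate relations
  `relOf T₀ = (all blocks, {w̄ = 0}, {w̄ = 1})`, and THE REDUCTION (`hsum_eq_zero_of_ref`): an admissible half-parity that is
  killed... rather: on `ker par2`, EVERY admissible `hsum A` coincides with `0` or with one `ψ(H_A, i)` — its saturation is a
  relation, hence (part II `sum_par_eq_zero_iff`) empty, all blocks, or a weight class, and canonicity applies; when `δ = 1`,
  `ψ(H, all) = ψ(H, w̄=0) + ψ(H, w̄=1)` (`hsum_halfOf_univ_eq_add`), when `δ = 0` only `ψ(H, all)` occurs.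
* §4 **THE UPPER BOUND** (`halfRank_le_card_mul`, `halfRank_le_card`, `halfRank_le`): for any finite set `𝓗` of subgroups containing
  every index-two `H ∋ c`, **`t(G, c) ≤ (1 + δ)·|𝓗|`** — the joint evaluation `hpi` of ALL admissible half-parities has, on
  `hodge2 ∩ ker par2`, a kernel containing that of the `(1 + δ)|𝓗|` reference functionals (rank–nullity, part III
  `finrank_map_add_finrank_inf_ker`).  With the floor: `β − 1 − δ + t ≤ φ₂` and `t ≤ (1 + δ)·h`, `h` = the number of index-two
  subgroups containing `c` (= the number of real quadratic subfields of the CM field) — André-3's table column «index-2 H ∋ c»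
  bounds the column «NEW»; the Klein relation of part II sharpens it further (`Q₈`: `h = 3`, `t = 2`).

## References
* [Pohlmann1968] H. Pohlmann, Algebraic cycles on abelian varieties of complex multiplication type, Ann. of Math. 88 (1968), Thm 1.
* [Milne1999] J. S. Milne, Lefschetz motives and the Tate conjecture, Compositio Math. 117 (1999), Prop. 2.1, p. 54.
-/

namespace Summit.HodgeConjecture.CorCM.Census.HalfParity

open Finset
open Summit.HodgeConjecture.CorCM.Prior.AllgGroup.RfwfAllgGroup
open Summit.HodgeConjecture.CorCM.Census.BlockParity
open Summit.HodgeConjecture.CorCM.Census.Coinvariant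

noncomputable section

variable {G : Type*} [Group G] [Fintype G] [DecidableEq G] (c : G)

/-! ## §1 No index-two subgroup containing `c`: `t = 0` -/

/-- **If no index-two subgroup contains `c`, there is no admissible half-parity and `t(G, c) = 0`.** [folklore] -/
theorem halfRank_eq_zero_of_forall_not_mem (hc2 : c * c = 1) (h : ∀ H : Subgroup G, H.index = 2 → c ∉ H) :
    halfRank c hc2 = 0 := by
  have h0 : hpi c hc2 = 0 := by
    apply LinearMap.ext
    intro x
    funext A
    obtain ⟨H, hH, hcH, -⟩ := (mem_admHalves c hc2 A.1).mp A.2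
    exact absurd hcH (h H hH)
  unfold halfRank
  rw [h0, Submodule.map_zero]
  exact finrank_bot (ZMod 2) _

/-! ## §2 Canonicity on the parity kernel -/

/-- **Two half-block sets of the same `H` with the same saturation agree on `ker par2`.** [folklore] -/
theorem hsum_eq_hsum_of_par2_eq_zero {H : Subgroup G} (hH : H.index = 2) {A₁ A₂ : Finset (CMF G c)}
    (hst₁ : ∀ Q ∈ H, ∀ Ψ ∈ A₁, rt c Q Ψ ∈ A₁) (hdj₁ : ∀ Q ∉ H, ∀ Ψ ∈ A₁, rt c Q Ψ ∉ A₁)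
    (hst₂ : ∀ Q ∈ H, ∀ Ψ ∈ A₂, rt c Q Ψ ∈ A₂) (hdj₂ : ∀ Q ∉ H, ∀ Ψ ∈ A₂, rt c Q Ψ ∉ A₂) (hsat : sat c A₁ = sat c A₂)
    {x : CMF G c →₀ ZMod 2} (hpx : par2 c x = 0) : hsum c A₁ x = hsum c A₂ x := by
  obtain ⟨a, ha⟩ := exists_hsum_add_hsum_eq_sum_par2 c hH hst₁ hdj₁ hst₂ hdj₂ hsat
  have h := ha x
  rw [hpx] at h
  simp only [Pi.zero_apply, mul_zero, Finset.sum_const_zero] at h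
  have key : ∀ u v : ZMod 2, u + v = 0 → u = v := by decide
  exact key _ _ h

/-! ## §3 Reference half-parities and the reduction -/

/-- The three candidate relations relative to a base type `T₀`: all blocks, `{w̄ = 0}`, `{w̄ = 1}`. [folklore] -/
def relOf (T₀ : CMF G c) : Fin 3 → Finset (Block c) :=
  ![univ, univ.filter fun b => wbar c T₀ b = 0, univ.filter fun b => wbar c T₀ b = 1]

/-- **The reference evaluation** on a set `𝓗` of subgroups: `x ↦ (hsum (halfOf H (relOf T₀ i)) x)_{H ∈ 𝓗, i ∈ I}` for an index
window `I ⊆ Fin 3` given as a map `e : ι → Fin 3`. [folklore] -/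
def refPi (T₀ : CMF G c) (𝓗 : Finset (Subgroup G)) {ι : Type*} (e : ι → Fin 3) :
    (CMF G c →₀ ZMod 2) →ₗ[ZMod 2] (↥𝓗 × ι → ZMod 2) :=
  LinearMap.pi fun p => hsum c (halfOf c p.1.1 (relOf c T₀ (e p.2)))

/-- `refPi x (H, i) = hsum (halfOf H (relOf T₀ (e i))) x`. [folklore] -/
@[simp] theorem refPi_apply (T₀ : CMF G c) (𝓗 : Finset (Subgroup G)) {ι : Type*} (e : ι → Fin 3) (x : CMF G c →₀ ZMod 2)
    (p : ↥𝓗 × ι) : refPi c T₀ 𝓗 e x p = hsum c (halfOf c p.1.1 (relOf c T₀ (e p.2))) x := rfl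

/-- A set with empty saturation is empty, and its half-sum vanishes. [folklore] -/
theorem hsum_eq_zero_of_sat_image_eq_empty {A : Finset (CMF G c)} (h : (sat c A).image (blk c) = ∅) (x : CMF G c →₀ ZMod 2) :
    hsum c A x = 0 := by
  have hA : A = ∅ := by
    have hs : sat c A = ∅ := Finset.image_eq_empty.mp h
    exact Finset.eq_empty_of_forall_notMem fun Ψ hΨ => by
      have := subset_sat c A hΨ
      rw [hs] at this
      exact Finset.notMem_empty _ this
  rw [hA, hsum_apply, Finset.sum_empty]

/-- **Reduction to a reference half-parity.**  An admissible `A` (via `H`) whose saturation has blocks `R` agrees on `ker par2` with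
`hsum (halfOf H R)`. [folklore] -/
theorem hsum_eq_hsum_halfOf {H : Subgroup G} (hH : H.index = 2) {A : Finset (CMF G c)}
    (hst : ∀ Q ∈ H, ∀ Ψ ∈ A, rt c Q Ψ ∈ A) (hdj : ∀ Q ∉ H, ∀ Ψ ∈ A, rt c Q Ψ ∉ A)
    {x : CMF G c →₀ ZMod 2} (hpx : par2 c x = 0) : hsum c A x = hsum c (halfOf c H ((sat c A).image (blk c))) x := by
  have hR : ∀ Ψ : CMF G c, blk c Ψ ∈ (sat c A).image (blk c) → stab c Ψ ≤ H := fun Ψ hΨ =>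
    stab_le_of_half c hH hdj ((mem_iff_blk_mem_image c (sat_stable c A) Ψ).mpr hΨ)
  refine hsum_eq_hsum_of_par2_eq_zero c hH hst hdj (halfOf_stable c H _) (halfOf_disjoint c H hR) ?_ hpx
  ext Ψ
  rw [mem_sat_halfOf_iff, ← mem_iff_blk_mem_image c (sat_stable c A)]

/-- For `δ = 1`, **`ψ(H, all) = ψ(H, w̄ = 0) + ψ(H, w̄ = 1)`**: `halfOf H univ` is the disjoint union of the two weight-class halves.
[folklore] -/
theorem hsum_halfOf_univ_eq_add (T₀ : CMF G c) (H : Subgroup G) (x : CMF G c →₀ ZMod 2) :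
    hsum c (halfOf c H univ) x =
      hsum c (halfOf c H (univ.filter fun b => wbar c T₀ b = 0)) x +
        hsum c (halfOf c H (univ.filter fun b => wbar c T₀ b = 1)) x := by
  have h01 : ∀ w : ZMod 2, w = 0 ∨ w = 1 := by decide
  have hunion : halfOf c H univ =
      halfOf c H (univ.filter fun b => wbar c T₀ b = 0) ∪ halfOf c H (univ.filter fun b => wbar c T₀ b = 1) := by
    ext Ψ
    rw [mem_union, mem_halfOf, mem_halfOf, mem_halfOf]
    constructor
    · rintro ⟨b, -, hb⟩
      rcases h01 (wbar c T₀ b) with h | h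
      · exact Or.inl ⟨b, mem_filter.mpr ⟨mem_univ _, h⟩, hb⟩
      · exact Or.inr ⟨b, mem_filter.mpr ⟨mem_univ _, h⟩, hb⟩
    · rintro (⟨b, -, hb⟩ | ⟨b, -, hb⟩) <;> exact ⟨b, mem_univ _, hb⟩
  have hdisj : Disjoint (halfOf c H (univ.filter fun b => wbar c T₀ b = 0))
      (halfOf c H (univ.filter fun b => wbar c T₀ b = 1)) := by
    rw [Finset.disjoint_left]
    intro Ψ h0 h1
    have e0 := (mem_filter.mp (blk_mem_of_mem_halfOf c H h0)).2
    have e1 := (mem_filter.mp (blk_mem_of_mem_halfOf c H h1)).2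
    rw [e0] at e1
    exact zero_ne_one e1
  rw [hunion, hsum_apply, hsum_apply, hsum_apply, Finset.sum_union hdisj]

/-- **THE REDUCTION, `δ` arbitrary.**  If every index-two `H ∋ c` lies in `𝓗` and `x ∈ ker par2` is killed by the reference
half-parities `ψ(H, w̄ = 0)`, `ψ(H, w̄ = 1)`, `ψ(H, all)` for `H ∈ 𝓗`, then EVERY admissible half-parity kills `x`. [folklore] -/
theorem hsum_eq_zero_of_ref (hc2 : c * c = 1) (T₀ : CMF G c) (𝓗 : Finset (Subgroup G))
    (h𝓗 : ∀ H : Subgroup G, H.index = 2 → c ∈ H → H ∈ 𝓗) {A : Finset (CMF G c)} (hA : A ∈ admHalves c hc2)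
    {x : CMF G c →₀ ZMod 2} (hpx : par2 c x = 0)
    (href : ∀ H ∈ 𝓗, ∀ i : Fin 3, hsum c (halfOf c H (relOf c T₀ i)) x = 0) : hsum c A x = 0 := by
  obtain ⟨H, hH, hcH, hst, hdj, hrel⟩ := (mem_admHalves c hc2 A).mp hA
  have hHm : H ∈ 𝓗 := h𝓗 H hH hcH
  have hR := sum_par_eq_zero_of_face2_le_ker_hsum c (sat_stable c A) hrel
  rcases (sum_par_eq_zero_iff c hc2 T₀ _).mp (fun Φ t t' ht' => hR Φ ht') with h0 | huniv | ⟨-, hW0 | hW1⟩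
  · exact hsum_eq_zero_of_sat_image_eq_empty c h0 x
  · rw [hsum_eq_hsum_halfOf c hH hst hdj hpx, huniv]; exact href H hHm 0
  · rw [hsum_eq_hsum_halfOf c hH hst hdj hpx, hW0]; exact href H hHm 1
  · rw [hsum_eq_hsum_halfOf c hH hst hdj hpx, hW1]; exact href H hHm 2

/-! ## §4 The upper bound `t ≤ (1 + δ)·h` -/

/-- **Dimension comparison**: if on `K = hodge2 ∩ ker par2` the kernel of a linear map `L` is contained in the kernel of `hpi`, then
`t ≤ dim L(K)`. [folklore] -/
theorem halfRank_le_finrank_map (hc2 : c * c = 1) {V' : Type*} [AddCommGroup V'] [Module (ZMod 2) V']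
    (L : (CMF G c →₀ ZMod 2) →ₗ[ZMod 2] V')
    (hL : hodge2 c hc2 ⊓ LinearMap.ker (par2 c) ⊓ LinearMap.ker L ≤ LinearMap.ker (hpi c hc2)) :
    halfRank c hc2 ≤ Module.finrank (ZMod 2) ↥((hodge2 c hc2 ⊓ LinearMap.ker (par2 c)).map L) := by
  have h1 := finrank_map_add_finrank_inf_ker (hpi c hc2) (hodge2 c hc2 ⊓ LinearMap.ker (par2 c))
  have h2 := finrank_map_add_finrank_inf_ker L (hodge2 c hc2 ⊓ LinearMap.ker (par2 c))
  have h3 : Module.finrank (ZMod 2) ↥(hodge2 c hc2 ⊓ LinearMap.ker (par2 c) ⊓ LinearMap.ker L) ≤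
      Module.finrank (ZMod 2) ↥(hodge2 c hc2 ⊓ LinearMap.ker (par2 c) ⊓ LinearMap.ker (hpi c hc2)) :=
    Submodule.finrank_mono (le_inf inf_le_left hL)
  unfold halfRank
  omega

/-- The kernel of a reference window whose index map hits every needed relation lies in `ker hpi` on the parity kernel.
[folklore] -/
theorem inf_ker_refPi_le (hc2 : c * c = 1) (T₀ : CMF G c) (𝓗 : Finset (Subgroup G))
    (h𝓗 : ∀ H : Subgroup G, H.index = 2 → c ∈ H → H ∈ 𝓗) {ι : Type*} (e : ι → Fin 3)
    (he : ∀ H ∈ 𝓗, ∀ x : CMF G c →₀ ZMod 2, (∀ i : ι, hsum c (halfOf c H (relOf c T₀ (e i))) x = 0) →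
      ∀ j : Fin 3, hsum c (halfOf c H (relOf c T₀ j)) x = 0) :
    hodge2 c hc2 ⊓ LinearMap.ker (par2 c) ⊓ LinearMap.ker (refPi c T₀ 𝓗 e) ≤ LinearMap.ker (hpi c hc2) := by
  intro x hx
  obtain ⟨⟨-, hpx⟩, hker⟩ := Submodule.mem_inf.mp hx |>.imp Submodule.mem_inf.mp id
  rw [LinearMap.mem_ker] at hpx hker ⊢
  funext A
  rw [hpi_apply, Pi.zero_apply]
  refine hsum_eq_zero_of_ref c hc2 T₀ 𝓗 h𝓗 A.2 hpx fun H hH j => he H hH x (fun i => ?_) j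
  have := congrFun hker (⟨H, hH⟩, i)
  rwa [refPi_apply] at this

/-- **`t ≤ 3·|𝓗|`** (all three candidate relations, no hypothesis on `δ`). [folklore] -/
theorem halfRank_le_three_mul (hc2 : c * c = 1) (T₀ : CMF G c) (𝓗 : Finset (Subgroup G))
    (h𝓗 : ∀ H : Subgroup G, H.index = 2 → c ∈ H → H ∈ 𝓗) : halfRank c hc2 ≤ 3 * 𝓗.card := by
  have h1 := halfRank_le_finrank_map c hc2 (refPi c T₀ 𝓗 (id : Fin 3 → Fin 3))
    (inf_ker_refPi_le c hc2 T₀ 𝓗 h𝓗 id fun H _ x hx j => hx j)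
  refine h1.trans ((Submodule.finrank_le _).trans ?_)
  rw [Module.finrank_fintype_fun_eq_card, Fintype.card_prod, Fintype.card_coe, Fintype.card_fin, mul_comm]

/-- **`t ≤ 2·|𝓗|`**: the relation «all blocks» is redundant (`ψ(H, all) = ψ(H, w̄=0) + ψ(H, w̄=1)`). [folklore] -/
theorem halfRank_le_two_mul (hc2 : c * c = 1) (T₀ : CMF G c) (𝓗 : Finset (Subgroup G))
    (h𝓗 : ∀ H : Subgroup G, H.index = 2 → c ∈ H → H ∈ 𝓗) : halfRank c hc2 ≤ 2 * 𝓗.card := by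
  have he : ∀ H ∈ 𝓗, ∀ x : CMF G c →₀ ZMod 2, (∀ i : Fin 2, hsum c (halfOf c H (relOf c T₀ (Fin.succ i))) x = 0) →
      ∀ j : Fin 3, hsum c (halfOf c H (relOf c T₀ j)) x = 0 := by
    intro H _ x hx j
    have h0 := hx 0
    have h1 := hx 1
    simp only [relOf, Fin.succ_zero_eq_one, Fin.succ_one_eq_two, Matrix.cons_val_one, Matrix.head_cons,
      Matrix.cons_val_two, Matrix.tail_cons, Matrix.cons_val_zero] at h0 h1
    fin_cases j
    · simp only [relOf, Fin.zero_eta, Matrix.cons_val_zero]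
      rw [hsum_halfOf_univ_eq_add c T₀, h0, h1, add_zero]
    · simpa [relOf] using h0
    · simpa [relOf] using h1
  have h1 := halfRank_le_finrank_map c hc2 (refPi c T₀ 𝓗 (Fin.succ : Fin 2 → Fin 3))
    (inf_ker_refPi_le c hc2 T₀ 𝓗 h𝓗 Fin.succ he)
  refine h1.trans ((Submodule.finrank_le _).trans ?_)
  rw [Module.finrank_fintype_fun_eq_card, Fintype.card_prod, Fintype.card_coe, Fintype.card_fin, mul_comm]

/-- **`δ = 0`: `t ≤ |𝓗|`** — without block-constant weight parity the only nonempty relation is «all blocks». [folklore] -/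
theorem halfRank_le_card (hc2 : c * c = 1) (T₀ : CMF G c) (hδ : wdelta c T₀ = 0) (𝓗 : Finset (Subgroup G))
    (h𝓗 : ∀ H : Subgroup G, H.index = 2 → c ∈ H → H ∈ 𝓗) : halfRank c hc2 ≤ 𝓗.card := by
  have hW : ¬ ∀ (Q : G) (Ψ : CMF G c), wpar c T₀ (rt c Q Ψ) = wpar c T₀ Ψ := fun h => by
    rw [wdelta_eq_one c h] at hδ; exact one_ne_zero hδ
  -- with `δ = 0` an admissible saturation is never a weight class: reduce to `ψ(H, all)` only
  have hL : hodge2 c hc2 ⊓ LinearMap.ker (par2 c) ⊓ LinearMap.ker (refPi c T₀ 𝓗 (fun _ : Unit => (0 : Fin 3))) ≤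
      LinearMap.ker (hpi c hc2) := by
    intro x hx
    obtain ⟨⟨-, hpx⟩, hker⟩ := Submodule.mem_inf.mp hx |>.imp Submodule.mem_inf.mp id
    rw [LinearMap.mem_ker] at hpx hker ⊢
    funext A
    rw [hpi_apply, Pi.zero_apply]
    obtain ⟨H, hH, hcH, hst, hdj, hrel⟩ := (mem_admHalves c hc2 A.1).mp A.2
    have hR := sum_par_eq_zero_of_face2_le_ker_hsum c (sat_stable c A.1) hrel
    rcases (sum_par_eq_zero_iff c hc2 T₀ _).mp (fun Φ t t' ht' => hR Φ ht') with h0 | huniv | ⟨hW', -⟩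
    · exact hsum_eq_zero_of_sat_image_eq_empty c h0 x
    · rw [hsum_eq_hsum_halfOf c hH hst hdj hpx, huniv]
      have := congrFun hker (⟨H, h𝓗 H hH hcH⟩, ())
      simpa [relOf] using this
    · exact absurd hW' hW
  refine (halfRank_le_finrank_map c hc2 _ hL).trans ((Submodule.finrank_le _).trans ?_)
  rw [Module.finrank_fintype_fun_eq_card, Fintype.card_prod, Fintype.card_coe, Fintype.card_unit, mul_one]

/-- **THE UPPER BOUND: `t(G, c) ≤ (1 + δ)·|𝓗|`** for any finite set `𝓗` of subgroups containing every index-two subgroup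
`H ∋ c` (so `t ≤ (1 + δ)·h`, `h` = the number of index-two subgroups containing `c`). [folklore] -/
theorem halfRank_le (hc2 : c * c = 1) (T₀ : CMF G c) (𝓗 : Finset (Subgroup G))
    (h𝓗 : ∀ H : Subgroup G, H.index = 2 → c ∈ H → H ∈ 𝓗) : halfRank c hc2 ≤ (1 + wdelta c T₀) * 𝓗.card := by
  rcases Nat.lt_or_ge (wdelta c T₀) 1 with h | h
  · have h0 : wdelta c T₀ = 0 := by omega
    rw [h0]
    simpa using halfRank_le_card c hc2 T₀ h0 𝓗 h𝓗
  · have h1 : wdelta c T₀ = 1 := le_antisymm (wdelta_le_one c T₀) h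
    rw [h1]
    exact halfRank_le_two_mul c hc2 T₀ 𝓗 h𝓗

/-- **The sandwich** with part III: `β − 1 − δ + t ≤ φ₂` and `t ≤ (1 + δ)·|𝓗|`. [folklore] -/
theorem card_block_add_halfRank_le_and (hc2 : c * c = 1) (T₀ : CMF G c) (𝓗 : Finset (Subgroup G))
    (h𝓗 : ∀ H : Subgroup G, H.index = 2 → c ∈ H → H ∈ 𝓗) :
    Fintype.card (Block c) + halfRank c hc2 ≤ fibreTwo c hc2 + 1 + wdelta c T₀ ∧
      halfRank c hc2 ≤ (1 + wdelta c T₀) * 𝓗.card :=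
  ⟨card_block_add_halfRank_le_fibreTwo_add c hc2 T₀, halfRank_le c hc2 T₀ 𝓗 h𝓗⟩


/-! ## Appendix (gen 30, same session): the intrinsic count `h(G, c)` and `t ≤ (1 + δ)·h` -/

/-- **`h(G, c)`** — the number of index-two subgroups of `G` containing `c` (for a Galois CM field `F`, `G = Gal(F/ℚ)`, `c` = complex
conjugation: the number of real quadratic subfields of `F`; André-3's column «index-2 H ∋ c»). [folklore] -/
def hTwo : ℕ := Nat.card {H : Subgroup G // H.index = 2 ∧ c ∈ H}

/-- **THE INTRINSIC UPPER BOUND: `t(G, c) ≤ (1 + δ(G, c)) · h(G, c)`.** [folklore] -/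
theorem halfRank_le_hTwo (hc2 : c * c = 1) (T₀ : CMF G c) : halfRank c hc2 ≤ (1 + wdelta c T₀) * hTwo c := by
  classical
  have hcard : (Finset.univ.filter fun H : Subgroup G => H.index = 2 ∧ c ∈ H).card = hTwo c := by
    rw [hTwo, Nat.card_eq_fintype_card, Fintype.card_subtype]
  rw [← hcard]
  exact halfRank_le c hc2 T₀ _ fun H h1 h2 => Finset.mem_filter.mpr ⟨Finset.mem_univ _, h1, h2⟩

/-- `δ`-free form: `t ≤ 2·h`. [folklore] -/
theorem halfRank_le_two_mul_hTwo (hc2 : c * c = 1) (hc1 : c ≠ 1) : halfRank c hc2 ≤ 2 * hTwo c := by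
  obtain ⟨T, hT⟩ := exists_isCMF c hc2 hc1
  have h1 := halfRank_le_hTwo c hc2 ⟨T, hT⟩
  have h2 : (1 + wdelta c ⟨T, hT⟩) * hTwo c ≤ 2 * hTwo c :=
    Nat.mul_le_mul_right _ (by have := wdelta_le_one c ⟨T, hT⟩; omega)
  exact h1.trans h2

/-- **`h(G, c) = 0 ⇒ t(G, c) = 0`** (`SL(2,3)`, `ℤ/2 × A₄`, …). [folklore] -/
theorem halfRank_eq_zero_of_hTwo_eq_zero (hc2 : c * c = 1) (hc1 : c ≠ 1) (h : hTwo c = 0) : halfRank c hc2 = 0 := by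
  have h1 := halfRank_le_two_mul_hTwo c hc2 hc1
  rw [h, mul_zero] at h1
  exact Nat.le_zero.mp h1

/-- **THE SANDWICH, intrinsic**: `β − 1 − δ + t ≤ φ₂` and `t ≤ (1 + δ)·h`, all four invariants of `(G, c)` alone. [folklore] -/
theorem sandwich (hc2 : c * c = 1) (T₀ : CMF G c) :
    Fintype.card (Block c) + halfRank c hc2 ≤ fibreTwo c hc2 + 1 + wdelta c T₀ ∧
      halfRank c hc2 ≤ (1 + wdelta c T₀) * hTwo c :=
  ⟨card_block_add_halfRank_le_fibreTwo_add c hc2 T₀, halfRank_le_hTwo c hc2 T₀⟩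

end

end Summit.HodgeConjecture.CorCM.Census.HalfParity
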